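import Literature.Geometry.Symplectic.SphereCROperatorJet
import Mathlib.Analysis.Calculus.BumpFunction.InnerProduct
import HarnessLib

/-!
# The Cauchy–Riemann operator of a sphere: globally smooth cut-off jet operators

Sequel to `SphereCROperatorJet.lean` (layer B4b of the analytic core of the Hofer–Lizan–Sikorav
local-foliation theorem, Wendl 2018 Thm. 2.46; lead of crux `WitnessCharge`, summit
`SmoothPoincare4`). The jet forms `jetOp₀ 𝒥`, `jetOp₁ 𝒥` of the transported Cauchy–Riemann
operator are smooth only on the open set `{den z c ≠ 0}` of the jet space
`Jet = ℂ × ℂ × (ℂ →L[ℝ] ℂ) × ℂ × (ℂ →L[ℝ] ℂ)` (`q = (z, c, c', t, t')`), because the exponential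
chart `expChart z c` degenerates where `den z c = 0`. The Nemytskii (composition) operators on
Hölder spaces want a *globally* `C^∞` map of the jet variables, so we cut off in the variable
`c`:

* `den_ne_zero_of_norm_lt_two` — `den z c ≠ 0` as soon as `‖c‖ < 2` (for every `z`);
* `cCut : ℂ → ℝ` — a smooth bump, `= 1` on `‖c‖ ≤ 1`, `= 0` on `3/2 ≤ ‖c‖`, values in `[0, 1]`,
  `tsupport cCut = closedBall 0 (3/2)`;
* `phiCut₀ 𝒥 q = cCut q.2.1 • jetOp₀ 𝒥 q` and `phiCut₁` — globally `C^∞` (`contDiff_phiCut₀`,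
  `contDiff_phiCut₁`), equal to the jet forms on `‖c‖ ≤ 1` (hence with the same derivative on
  `‖c‖ < 1`), and vanishing on the zero section (`phiCut₀_axis`);
* the generic localisation lemma `contDiff_smul_of_contDiffOn` (a smooth scalar cut-off with
  `tsupport` inside an open set `U` times a map smooth on `U` is globally smooth), and the record
  that `Jet` is finite-dimensional and complete (instances found by `inferInstance`).

Since the unknown vector field `ξ` of the deformation problem is small in `C^0` (indeed `‖ξ‖ < δ`
with `δ ≤ 1`), the cut-off never changes the operator on the relevant ball; it only makes the
composition map globally defined and smooth.

## References

* C. Wendl, *Holomorphic Curves in Low Dimensions*, LNM 2216 (2018), §2.3, Thm. 2.46. [Wendl2018]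
-/

noncomputable section

open Complex Set Filter Metric
open scoped Topology ContDiff
open Literature.Analysis.Complex.ProjectiveLineExpChart

namespace Literature.Geometry.Symplectic

namespace SphereCR

/-! ### Nondegeneracy of the exponential chart for `‖c‖ < 2` -/

/-- **`den z c ≠ 0` whenever `‖c‖ < 2`**: indeed `‖c conj z‖ = ‖c‖ ‖z‖ < 1 + ‖z‖² = ‖1 + |z|²‖`
(`1 + ‖z‖² - ‖c‖ ‖z‖ = 1 - ‖c‖²/4 + (‖z‖ - ‖c‖/2)² > 0`). [folklore] -/
theorem den_ne_zero_of_norm_lt_two {z c : ℂ} (hc : ‖c‖ < 2) : den z c ≠ 0 := by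
  intro h
  have h1 : (1 + (Complex.normSq z : ℂ)) = c * (starRingEnd ℂ) z := sub_eq_zero.1 h
  have h2 : 1 + ‖z‖ ^ 2 = ‖c‖ * ‖z‖ := by
    have h3 := congrArg norm h1
    rwa [norm_one_add_normSq, norm_mul, Complex.norm_conj] at h3
  nlinarith [norm_nonneg z, norm_nonneg c, sq_nonneg (‖z‖ - ‖c‖ / 2),
    mul_nonneg (norm_nonneg c) (sub_pos.2 hc).le]

/-- The jet domain `{q | den q.1 q.2.1 ≠ 0}` is open. [folklore] -/
theorem isOpen_jet_den_ne_zero : IsOpen {q : Jet | den q.1 q.2.1 ≠ 0} :=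
  isOpen_den_ne_zero.preimage (continuous_fst.prodMk (continuous_fst.comp continuous_snd))

/-! ### The cut-off in the variable `c` -/

/-- The bump datum: radii `1 < 3/2` around `0 ∈ ℂ`. [folklore] -/
def cBump : ContDiffBump (0 : ℂ) := ⟨1, 3 / 2, one_pos, by norm_num⟩

/-- **The cut-off `cCut : ℂ → [0, 1]`**: smooth, `= 1` on `‖c‖ ≤ 1`, `= 0` on `3/2 ≤ ‖c‖`
(Mathlib's bump function of the inner product space `ℂ`). [folklore] -/
def cCut (c : ℂ) : ℝ := cBump c

/-- `cCut` is `C^∞`. [folklore] -/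
theorem contDiff_cCut {n : ℕ∞} : ContDiff ℝ n cCut := cBump.contDiff

/-- `cCut` is continuous. [folklore] -/
theorem continuous_cCut : Continuous cCut := cBump.continuous

/-- `cCut c = 1` for `‖c‖ ≤ 1`. [folklore] -/
theorem cCut_eq_one {c : ℂ} (h : ‖c‖ ≤ 1) : cCut c = 1 :=
  cBump.one_of_mem_closedBall (by simpa [cBump] using h)

/-- `cCut c = 0` for `3/2 ≤ ‖c‖`. [folklore] -/
theorem cCut_eq_zero {c : ℂ} (h : 3 / 2 ≤ ‖c‖) : cCut c = 0 :=
  cBump.zero_of_le_dist (by simpa [cBump] using h)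

/-- `0 ≤ cCut c`. [folklore] -/
theorem cCut_nonneg (c : ℂ) : 0 ≤ cCut c := cBump.nonneg

/-- `cCut c ≤ 1`. [folklore] -/
theorem cCut_le_one (c : ℂ) : cCut c ≤ 1 := cBump.le_one

/-- `tsupport cCut = closedBall 0 (3/2)`. [folklore] -/
theorem tsupport_cCut : tsupport cCut = closedBall (0 : ℂ) (3 / 2) := cBump.tsupport_eq

/-- `cCut` has compact support. [folklore] -/
theorem hasCompactSupport_cCut : HasCompactSupport cCut := cBump.hasCompactSupport

/-- On the support of the cut-off the chart is nondegenerate: `c ∈ tsupport cCut → den z c ≠ 0`.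
[folklore] -/
theorem den_ne_zero_of_mem_tsupport_cCut {z c : ℂ} (h : c ∈ tsupport cCut) : den z c ≠ 0 := by
  rw [tsupport_cCut, mem_closedBall, dist_zero_right] at h
  exact den_ne_zero_of_norm_lt_two (by linarith)

/-- The pulled-back cut-off `q ↦ cCut q.2.1` has `tsupport` inside the jet domain. [folklore] -/
theorem tsupport_cCut_jet_subset :
    tsupport (fun q : Jet => cCut q.2.1) ⊆ {q : Jet | den q.1 q.2.1 ≠ 0} := fun _ hq =>
  den_ne_zero_of_mem_tsupport_cCut
    (tsupport_comp_subset_preimage cCut (f := fun q : Jet => q.2.1)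
      (continuous_fst.comp continuous_snd) hq)

/-! ### Localisation: cut-off times a map smooth on an open set -/

section SmulOpen

variable {E G : Type*} [NormedAddCommGroup E] [NormedSpace ℝ E] [NormedAddCommGroup G]
  [NormedSpace ℝ G]

/-- **`χ • T` is globally `Cⁿ`** when `χ ∈ Cⁿ(E, ℝ)` has `tsupport χ` inside an open set `U` on
which `T` is `Cⁿ`: near points of `U` it is a product of `Cⁿ` maps, near the other points it
vanishes identically. (Same statement as the Hölder-space localisation lemma of
`Literature/Analysis/FunctionSpaces/ContDiffHolderLocalization.lean`, restated here to keep the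
import closure small; no compact support is needed.) [folklore] -/
theorem contDiff_smul_of_contDiffOn {n : WithTop ℕ∞} {χ : E → ℝ} (hχ : ContDiff ℝ n χ)
    {T : E → G} {U : Set E} (hU : IsOpen U) (hT : ContDiffOn ℝ n T U) (hχU : tsupport χ ⊆ U) :
    ContDiff ℝ n fun y => χ y • T y := by
  rw [contDiff_iff_contDiffAt]
  intro y
  by_cases hy : y ∈ U
  · exact hχ.contDiffAt.smul (hT.contDiffAt (hU.mem_nhds hy))
  · have hy' : y ∉ tsupport χ := fun h => hy (hχU h)
    have hev : (fun y => χ y • T y) =ᶠ[𝓝 y] fun _ => (0 : G) := by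
      filter_upwards [notMem_tsupport_iff_eventuallyEq.1 hy'] with w hw
      simp [hw]
    exact (contDiffAt_const (c := (0 : G))).congr_of_eventuallyEq hev

end SmulOpen

/-! ### The jet space is finite-dimensional and complete -/

/-- `Jet` is finite-dimensional over `ℝ` (instance found by typeclass inference; recorded for the
Nemytskii operators, which require a finite-dimensional source). [folklore] -/
example : FiniteDimensional ℝ Jet := inferInstance

/-- `Jet` is complete (instance found by typeclass inference). [folklore] -/
example : CompleteSpace Jet := inferInstance

/-- The set `{q | ‖q.2.1‖ < 1}` where the cut-off is inactive is open. [folklore] -/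
theorem isOpen_jet_norm_lt_one : IsOpen {q : Jet | ‖q.2.1‖ < 1} :=
  isOpen_lt (continuous_norm.comp (continuous_fst.comp continuous_snd)) continuous_const

namespace SphereACData

variable (𝒥 : SphereACData)

/-! ### The cut-off chart-`0` operator -/

/-- **The globally defined chart-`0` jet operator** `phiCut₀ q = cCut c • jetOp₀ q`
(`q = (z, c, c', t, t')`). [cite: Wendl2018, Thm. 2.46] -/
def phiCut₀ (q : Jet) : ℂ × ℂ := (cCut q.2.1) • 𝒥.jetOp₀ q

/-- `phiCut₀` unfolded. [folklore] -/
theorem phiCut₀_apply (q : Jet) : 𝒥.phiCut₀ q = (cCut q.2.1) • 𝒥.jetOp₀ q := rfl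

/-- **`phiCut₀` is globally `C^∞`.** [folklore] -/
theorem contDiff_phiCut₀ : ContDiff ℝ ∞ 𝒥.phiCut₀ :=
  contDiff_smul_of_contDiffOn (contDiff_cCut.comp (contDiff_fst.comp contDiff_snd))
    isOpen_jet_den_ne_zero 𝒥.contDiffOn_jetOp₀ tsupport_cCut_jet_subset

/-- On `‖c‖ ≤ 1` the cut-off is inactive: `phiCut₀ q = jetOp₀ q`. [folklore] -/
theorem phiCut₀_eq_jetOp₀ {q : Jet} (h : ‖q.2.1‖ ≤ 1) : 𝒥.phiCut₀ q = 𝒥.jetOp₀ q := by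
  rw [phiCut₀_apply, cCut_eq_one h, one_smul]

/-- On `3/2 ≤ ‖c‖` the cut-off kills the operator: `phiCut₀ q = 0`. [folklore] -/
theorem phiCut₀_eq_zero {q : Jet} (h : 3 / 2 ≤ ‖q.2.1‖) : 𝒥.phiCut₀ q = 0 := by
  rw [phiCut₀_apply, cCut_eq_zero h, zero_smul]

/-- Near a jet with `‖c‖ < 1`, `phiCut₀` and `jetOp₀` agree as germs. [folklore] -/
theorem phiCut₀_eventuallyEq {q : Jet} (h : ‖q.2.1‖ < 1) : 𝒥.phiCut₀ =ᶠ[𝓝 q] 𝒥.jetOp₀ := by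
  filter_upwards [isOpen_jet_norm_lt_one.mem_nhds h] with q' hq'
  exact 𝒥.phiCut₀_eq_jetOp₀ (le_of_lt hq')

/-- Hence the derivatives agree at jets with `‖c‖ < 1`. [folklore] -/
theorem fderiv_phiCut₀ {q : Jet} (h : ‖q.2.1‖ < 1) :
    fderiv ℝ 𝒥.phiCut₀ q = fderiv ℝ 𝒥.jetOp₀ q :=
  (𝒥.phiCut₀_eventuallyEq h).fderiv_eq

/-- `jetOp₀` is `C^∞` at every jet with `‖c‖ < 2`. [folklore] -/
theorem contDiffAt_jetOp₀ {q : Jet} (h : ‖q.2.1‖ < 2) : ContDiffAt ℝ ∞ 𝒥.jetOp₀ q :=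
  𝒥.contDiffOn_jetOp₀.contDiffAt
    (isOpen_jet_den_ne_zero.mem_nhds (den_ne_zero_of_norm_lt_two h))

/-- The zero section is mapped to zero: `phiCut₀ (z, 0, 0, 0, 0) = 0`. [folklore] -/
theorem phiCut₀_axis (z : ℂ) : 𝒥.phiCut₀ (z, 0, 0, 0, 0) = 0 := by
  rw [phiCut₀_apply, jetOp₀_zero, smul_zero]

/-! ### The cut-off chart-`1` operator -/

/-- The zero section in chart-`1` jet form: `jetOp₁ (w, 0, 0, 0, 0) = 0`. [folklore] -/
theorem jetOp₁_zero (w : ℂ) : 𝒥.jetOp₁ (w, 0, 0, 0, 0) = 0 :=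
  𝒥.swap.jetOp₀_zero w

/-- **The globally defined chart-`1` jet operator** `phiCut₁ q = cCut c • jetOp₁ q`.
[cite: Wendl2018, Thm. 2.46] -/
def phiCut₁ (q : Jet) : ℂ × ℂ := (cCut q.2.1) • 𝒥.jetOp₁ q

/-- `phiCut₁` unfolded. [folklore] -/
theorem phiCut₁_apply (q : Jet) : 𝒥.phiCut₁ q = (cCut q.2.1) • 𝒥.jetOp₁ q := rfl

/-- `phiCut₁ = swap.phiCut₀`, definitionally. [folklore] -/
theorem swap_phiCut₀ : 𝒥.swap.phiCut₀ = 𝒥.phiCut₁ := rfl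

/-- `jetOp₁ = swap.jetOp₀`, definitionally. [folklore] -/
theorem swap_jetOp₀ : 𝒥.swap.jetOp₀ = 𝒥.jetOp₁ := rfl

/-- **`phiCut₁` is globally `C^∞`.** [folklore] -/
theorem contDiff_phiCut₁ : ContDiff ℝ ∞ 𝒥.phiCut₁ :=
  𝒥.swap.contDiff_phiCut₀

/-- On `‖c‖ ≤ 1`: `phiCut₁ q = jetOp₁ q`. [folklore] -/
theorem phiCut₁_eq_jetOp₁ {q : Jet} (h : ‖q.2.1‖ ≤ 1) : 𝒥.phiCut₁ q = 𝒥.jetOp₁ q :=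
  𝒥.swap.phiCut₀_eq_jetOp₀ h

/-- On `3/2 ≤ ‖c‖`: `phiCut₁ q = 0`. [folklore] -/
theorem phiCut₁_eq_zero {q : Jet} (h : 3 / 2 ≤ ‖q.2.1‖) : 𝒥.phiCut₁ q = 0 :=
  𝒥.swap.phiCut₀_eq_zero h

/-- Near a jet with `‖c‖ < 1`, `phiCut₁` and `jetOp₁` agree as germs. [folklore] -/
theorem phiCut₁_eventuallyEq {q : Jet} (h : ‖q.2.1‖ < 1) : 𝒥.phiCut₁ =ᶠ[𝓝 q] 𝒥.jetOp₁ :=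
  𝒥.swap.phiCut₀_eventuallyEq h

/-- Hence the derivatives agree at jets with `‖c‖ < 1`. [folklore] -/
theorem fderiv_phiCut₁ {q : Jet} (h : ‖q.2.1‖ < 1) :
    fderiv ℝ 𝒥.phiCut₁ q = fderiv ℝ 𝒥.jetOp₁ q :=
  𝒥.swap.fderiv_phiCut₀ h

/-- `jetOp₁` is `C^∞` at every jet with `‖c‖ < 2`. [folklore] -/
theorem contDiffAt_jetOp₁ {q : Jet} (h : ‖q.2.1‖ < 2) : ContDiffAt ℝ ∞ 𝒥.jetOp₁ q :=
  𝒥.swap.contDiffAt_jetOp₀ h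

/-- The zero section is mapped to zero: `phiCut₁ (w, 0, 0, 0, 0) = 0`. [folklore] -/
theorem phiCut₁_axis (w : ℂ) : 𝒥.phiCut₁ (w, 0, 0, 0, 0) = 0 :=
  𝒥.swap.phiCut₀_axis w

end SphereACData

end SphereCR

end Literature.Geometry.Symplectic

end
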